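import Literature.MathematicalPhysics.QuantumFieldTheory.Balaban1983to89.B9Eq324DeltaPrimeATower
import Literature.MathematicalPhysics.QuantumFieldTheory.Balaban1983to89.B9Eq325ProjFormula

/-!
# `Balaban1983to89.B9Eq325ProjFormulaTower` — T. Bałaban, *Propagators for lattice gauge theories in a background field*, Commun. Math. Phys.
# **99** (1985) 389–434 [Balaban1985BackgroundPropagators] (3.21)–(3.25) p. 394, (3.19) p. 393, Thm 3.11 p. 416: **(3.25) `R = Δ_U G′Q′*(Q′G′²Q′*)⁻¹Q′G′`
# FOR PRINT's `k`-TH-STEP PROJECTION `R_k(U)` (`B9Eq326OperatorTower.RofUk`, the orthogonal projection onto `Δ^η_U N(Q′_k(U))` with the COMPOSITE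
# site averaging `Q′_k(U)`), `G′_k = (Δ′_{a′,k}(U))⁻¹` of `B9Eq324DeltaPrimeATower`; THE THIRD OPERATOR `Q̃′_kG′_k²Q̃′_k†` POSITIVE DEFINITE; AND
# AT `U ≡ 1` THE `k`-LEVEL THIRD OPERATOR IS LITERALLY THE ONE-STEP THIRD OPERATOR AT BLOCK SIZE `L^{n+1}`** — NE9 leaf-06's one-step
# `B9Eq325ProjFormula` §2–§4 ONE STOREY UP, the abstract §1 (`projR_eq_formula`, `qggq_pos`) reused BY NAME

statement-level skeleton of published theorems with citation tags; proofs where landed; nothing here is a claim about the Yang–Mills mass gap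

CITATION HEADER (lean-in-tree rule).  Audit cell `pub-balaban`, sub-cell `t4`, BINDER row NE9; filed by the row OWNER lineage `b2b-balaban-t4-ne9-p1`
(gen 85), INTENT I-ne9p1-g85-2.  Sources READ by this lineage in the held text `paper:balaban1985-cmp99-background-propagators` (journal page = PDF
page + 388): pp. 393–395, 416.

THE PRINT (verbatim).  p. 394, (3.21): *«R = R(U) is the orthogonal projection onto ℛ = Δ^η_U N(Q′)»*; (3.25): *«G′ = (Δ′_a)⁻¹, R = Δ_U G′ Q′*(Q′G′²Q′*)⁻¹Q′G′»*;
p. 393, (3.19): *«Q′_j(U) = Q′(Ū^{j−1}) … Q′(U)»* (the site averaging of the `j`-th step is the COMPOSITE one); p. 416, Thm 3.11: *«the operators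
Δ′_a, G′, (Q′G′²Q′*)⁻¹, Δ_a, G are positive definite.»*

WHY THIS FILE (cell context; the owner's DIAGNOSIS D-ne9p1-g85-1).  The `k`-level `R`-Lipschitz letter `C_R` is the one letter of the `k`-level
strong small-field coercivity (SC-k) not closed at print's point (PRICING-NE9 v69).  NE9 leaf-06 closed the ONE-STEP `C_R` through PRINT's
representation (3.25) (`B9Eq325ProjFormula` → `B9Eq325RLipschitzResolvent` → `B9Eq364GreenLipschitzForm` → `B9Eq325RLipschitzClosed`), all of
whose letters are FORM letters, (η, L, volume)-free on the diagonal.  This file is the first storey of that chain for the composite averaging: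
(3.25) for `RofUk`, so that the resolvent∕Green∕closure files port by text substitution (`RofU ↦ RofUk`, `QprimeW ↦ QprimeTowerW`,
`laplacePrimeA ↦ laplacePrimeAk`, `GpOfU ↦ GpOfUk`); and the flat third operator identified with the one-step one at block `L^{n+1}`, so
that NE9 leaf-01's flat floor `κ♭` (`B9Eq365QGGQLowerVariational.qggq_coercive_one` ∕ `qggq_constant_diagonal_ge`) is consumed BY NAME.

WHAT IS PROVED (sorry-free; no `def`, no `Prop` placeholder; no inequality of the paper asserted).
* §1 **`QGGQk_pos`** — Thm 3.11's third operator for the composite averaging, `Q̃′_kG′_k²Q̃′_k†`, is positive definite on `SiteL2K ℂ d m c₁ W` at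
  mutually adjoint transporters (`hRS`) and the displayed positivity `hpos′` of `Δ′_{a′,k}(U)` (onto by `QprimeTowerW_surjective`);
  **`RofUk_eq_formula : RofUk L m n φ η U f = f − G′_k(Q̃′_k†((Q̃′_kG′_k²Q̃′_k†)⁻¹(Q̃′_k(G′_kf))))`** (`projR_eq_formula` BY NAME).
* §2 `QGGQk_pos_of_unitary`, `RofUk_eq_formula_of_unitary` — `hRS` discharged at every unitary background (`B9Eq310HessianHermitian.adTransportW_adjoint`),
  `hpos′` still displayed (no `k`-level kernel clause; the chain takes it from the small-field coercivity, `B9Eq324DeltaPrimeATower.laplacePrimeAk_pos_of_coercive`).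
* §3 `adTransportW_adjoint_one_tower`, **`QGGQk_pos_one`**, **`RofUk_eq_formula_one`** — at `U ≡ 1` no letter at all (`η ≠ 0`, `0 < a′`).
* §4 **`QGGQk_one_eq_oneStep`** — `Q̃′_kG′_k(1)²Q̃′_k† = Q̃′G′^{(L^{n+1})}(1)²Q̃′†` as operators on `SiteL2K ℂ d m c₁ W`, LITERALLY (the site isometry
  `Φ′` of `B9Eq316TowerFlatIsOneStep` cancels three times), for any positivity witnesses; `re_inner_QGGQk_one_eq_oneStep` (the form reading).
MODEL ∕ DECLARED READINGS.  As `B9Eq324DeltaPrimeATower` (M1)–(M6): positivity of `Δ′_{a′,k}(U)` at `U ≠ 1` displayed; MECHANISM [folklore] =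
leaf-06's §1 (orthogonality characterisation of `starProjection`), not a new argument.  NOT HERE: any estimate, any uniformity.
HONEST SCOPE.  [folklore] the chain's own (3.25) one storey up by name; NOT summit progress (cell pub-balaban: NE9 NOT PRINTED ∕ NOT PROVED, «NE9 ⇐
the named binders»; row WALLED ON A MODEL; spine PROVED 0/9; rung (B)+1 finite T⁴ — NOT infinite volume, NOT mass gap, NOT Clay; HONEST DEPENDENCY:
continuum YM on T⁴ ⇐ BetaPertH ∧ nine spine estimates (0/9 proved); BetaPertH ⇐ (D1) ∧ (D4) ∧ CAP+tail; G-an2-4 gates asym, D1 and NE2/3/4).  NEW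
file importing `B9Eq324DeltaPrimeATower` and `B9Eq325ProjFormula`; nothing modified.  Net new unproved facts: 0.
-/

noncomputable section

open scoped InnerProductSpace ComplexConjugate

namespace Literature.MathematicalPhysics.QuantumFieldTheory.Balaban1983to89.B9Eq325ProjFormulaTower

open B4Sect5Torus (TSite)
open B9SectCLatticeCarrier (Bond)
open B9Eq311L2Pairing (WL2)
open B9Eq319QprimeTorus (fineP)
open B11Eq103H1Complex (SiteL2K covLaplaceSiteK greenK apply_greenK greenK_apply)
open B9Eq310HessianOperator (adTransportW adTransportW_apply)
open B9Eq310HessianHermitian (adTransportW_adjoint)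
open B9Eq315QTower (towerP)
open B9Eq326OperatorAssembly (QprimeW)
open B9Eq326OperatorTower (QprimeTowerW QprimeTowerW_surjective RofUk)
open B9Eq3119DeltaPiCarrier (laplacePrimeA GpOfU)
open B9Thm311DeltaPrimeA (laplacePrimeA_one_pos)
open B9Eq325ProjFormula (projR_eq_formula qggq_pos)
open B9Eq316TowerFlatIsOneStep (siteL2Cast)
open B9Eq324DeltaPrimeATower (laplacePrimeAk laplacePrimeAk_apply_of_ker laplacePrimeAk_isSymmetric GpOfUk laplacePrimeAk_one_pos
  Qtildek_one_eq_oneStep adjoint_comp_siteL2Cast GpOfUk_one_eq_oneStep)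

/-! ## §1 (3.25) for `R_k(U)`: the third operator positive definite, and the formula -/

section Chain

variable {d : ℕ} (L : ℕ) [NeZero L] (m : Fin d → ℕ) [∀ i, NeZero (m i)] (n : ℕ)
  {𝔸 : Type*} [NormedRing 𝔸] [NormedAlgebra ℂ 𝔸] [CompleteSpace 𝔸] [NormOneClass 𝔸]
  {W : Type*} [NormedAddCommGroup W] [InnerProductSpace ℂ W] [FiniteDimensional ℂ W] (φ : W ≃ₗ[ℂ] 𝔸) (c₀ : ℝ) [Fact (0 < c₀)]
  (η : ℝ) (U : Bond d (towerP L m (n + 1)) → 𝔸ˣ) (c₁ : ℝ) [Fact (0 < c₁)] (a' : ℝ)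
  (hRS : ∀ (b : Bond d (towerP L m (n + 1))) (v u : W), ⟪adTransportW φ U b v, u⟫_ℂ = ⟪v, adTransportW φ (fun b => (U b)⁻¹) b u⟫_ℂ)
  (hpos' : ∀ x : SiteL2K ℂ d (towerP L m (n + 1)) c₀ W, x ≠ 0 → 0 < RCLike.re ⟪x, laplacePrimeAk L m n φ η U a' (c₁ := c₁) x⟫_ℂ)

omit [NormOneClass 𝔸] in
include hRS in
/-- **Thm 3.11's THIRD operator for the composite averaging: `Q̃′_kG′_k(U)²Q̃′_k†` IS POSITIVE DEFINITE** on the `L²` space of the unit lattice (`G′_k(U) =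
(Δ′_{a′,k}(U))⁻¹ = GpOfUk` at the displayed positivity `hpos′`, `Q̃′_k(U)` = `QprimeTowerW` read into the weight-`c₁` carrier, onto by
`B9Eq326OperatorTower.QprimeTowerW_surjective`) — so that `(Q̃′_kG′_k²Q̃′_k†)⁻¹` is CONSTRUCTED as `greenK … (QGGQk_pos …)`; leaf-06's abstract `qggq_pos`.
[cite: Balaban1985BackgroundPropagators, Thm 3.11 p.416, (3.25) p.394, (3.19) p.393] -/
theorem QGGQk_pos (ψ : SiteL2K ℂ d m c₁ W) (hψ : ψ ≠ 0) :
    0 < RCLike.re ⟪ψ, (((WL2.linearEquiv ℂ ℂ (fun _ : TSite d m => c₁)).symm.toLinearMap ∘ₗ QprimeTowerW L m n φ U (c₀ := c₀)) ∘ₗ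
        GpOfUk L m n φ η U a' (c₁ := c₁) hpos' ∘ₗ GpOfUk L m n φ η U a' (c₁ := c₁) hpos' ∘ₗ
          LinearMap.adjoint ((WL2.linearEquiv ℂ ℂ (fun _ : TSite d m => c₁)).symm.toLinearMap ∘ₗ QprimeTowerW L m n φ U (c₀ := c₀))) ψ⟫_ℂ :=
  qggq_pos _ (laplacePrimeAk_isSymmetric L m n φ η U a' (c₀ := c₀) (c₁ := c₁) hRS) hpos'
    (((WL2.linearEquiv ℂ ℂ (fun _ : TSite d m => c₁)).symm.surjective).comp (QprimeTowerW_surjective L m n φ U)) ψ hψ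

omit [NormOneClass 𝔸] in
include hRS in
/-- **(3.25) FOR PRINT's `k`-TH-STEP PROJECTION `R_k(U)`**: `B9Eq326OperatorTower.RofUk` — the orthogonal projection onto `Δ^η_U N(Q′_k(U))` — equals
`f ↦ f − G′_k(Q̃′_k†((Q̃′_kG′_k²Q̃′_k†)⁻¹(Q̃′_k(G′_kf))))` with `G′_k = GpOfUk` at the displayed positivity, `Q̃′_k` = `QprimeTowerW` read into the
weight-`c₁` carrier, `Q̃′_k†` its Hilbert adjoint and `(Q̃′_kG′_k²Q̃′_k†)⁻¹ := greenK … (QGGQk_pos …)` — leaf-06's `projR_eq_formula` with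
`Δ′ = Δ^η_U` on `N(Q′_k(U))` (`laplacePrimeAk_apply_of_ker`), `laplacePrimeAk_isSymmetric`, `apply_greenK` twice.
[cite: Balaban1985BackgroundPropagators, (3.21) p.394, (3.25) p.394, (3.19) p.393] -/
theorem RofUk_eq_formula (f : SiteL2K ℂ d (towerP L m (n + 1)) c₀ W) :
    RofUk L m n φ η U (c₀ := c₀) f = f - GpOfUk L m n φ η U a' (c₁ := c₁) hpos'
      (LinearMap.adjoint ((WL2.linearEquiv ℂ ℂ (fun _ : TSite d m => c₁)).symm.toLinearMap ∘ₗ QprimeTowerW L m n φ U (c₀ := c₀))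
        (greenK _ (QGGQk_pos L m n φ c₀ η U c₁ a' hRS hpos')
          (((WL2.linearEquiv ℂ ℂ (fun _ : TSite d m => c₁)).symm.toLinearMap ∘ₗ QprimeTowerW L m n φ U (c₀ := c₀))
            (GpOfUk L m n φ η U a' (c₁ := c₁) hpos' f)))) := by
  have hker : ∀ l : SiteL2K ℂ d (towerP L m (n + 1)) c₀ W,
      ((WL2.linearEquiv ℂ ℂ (fun _ : TSite d m => c₁)).symm.toLinearMap ∘ₗ QprimeTowerW L m n φ U (c₀ := c₀)) l = 0 ↔
        QprimeTowerW L m n φ U l = 0 :=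
    fun l => by rw [LinearMap.comp_apply, LinearEquiv.coe_toLinearMap, LinearEquiv.map_eq_zero_iff]
  have hg : ∀ x : SiteL2K ℂ d (towerP L m (n + 1)) c₀ W,
      laplacePrimeAk L m n φ η U a' (c₁ := c₁) (GpOfUk L m n φ η U a' (c₁ := c₁) hpos' x) = x :=
    fun x => apply_greenK hpos' x
  have hc := apply_greenK (QGGQk_pos L m n φ c₀ η U c₁ a' hRS hpos')
  simp only [LinearMap.comp_apply] at hc
  exact projR_eq_formula (𝕜 := ℂ) _ (laplacePrimeAk L m n φ η U a' (c₁ := c₁)) (GpOfUk L m n φ η U a' (c₁ := c₁) hpos') (QprimeTowerW L m n φ U)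
    ((WL2.linearEquiv ℂ ℂ (fun _ : TSite d m => c₁)).symm.toLinearMap ∘ₗ QprimeTowerW L m n φ U (c₀ := c₀))
    (LinearMap.adjoint ((WL2.linearEquiv ℂ ℂ (fun _ : TSite d m => c₁)).symm.toLinearMap ∘ₗ QprimeTowerW L m n φ U (c₀ := c₀))) _
    hker (fun l hl => laplacePrimeAk_apply_of_ker L m n φ η U a' hl) (laplacePrimeAk_isSymmetric L m n φ η U a' (c₀ := c₀) (c₁ := c₁) hRS)
    (fun x ψ => (LinearMap.adjoint_inner_right _ x ψ).symm) hg hc f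

end Chain

/-! ## §2 At every unitary background: `hRS` discharged, `hpos′` displayed -/

section Unitary

variable {d : ℕ} (L : ℕ) [NeZero L] (m : Fin d → ℕ) [∀ i, NeZero (m i)] (n : ℕ)
  {𝔸 : Type*} [NormedRing 𝔸] [NormedAlgebra ℂ 𝔸] [CompleteSpace 𝔸] [NormOneClass 𝔸] [StarRing 𝔸] [StarModule ℂ 𝔸]
  {W : Type*} [NormedAddCommGroup W] [InnerProductSpace ℂ W] [FiniteDimensional ℂ W] (φ : W ≃ₗ[ℂ] 𝔸) (c₀ : ℝ) [Fact (0 < c₀)]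
  (η : ℝ) (U : Bond d (towerP L m (n + 1)) → 𝔸ˣ) (c₁ : ℝ) [Fact (0 < c₁)] (a' : ℝ) (τ : 𝔸 →ₗ[ℂ] ℂ)
  (hτ₂ : ∀ X Y : 𝔸, τ (X * Y) = τ (Y * X)) (hφ : ∀ X Y : 𝔸, ⟪φ.symm X, φ.symm Y⟫_ℂ = τ (star X * Y))
  (hU : ∀ b, star (U b : 𝔸) = ((U b)⁻¹ : 𝔸ˣ))
  (hpos' : ∀ x : SiteL2K ℂ d (towerP L m (n + 1)) c₀ W, x ≠ 0 → 0 < RCLike.re ⟪x, laplacePrimeAk L m n φ η U a' (c₁ := c₁) x⟫_ℂ)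

include hτ₂ hφ hU

omit [NormOneClass 𝔸] [StarModule ℂ 𝔸] in
/-- **The third operator at a unitary background** (tracial `τ`, the cell's norming `⟪φ⁻¹X, φ⁻¹Y⟫ = τ(X*Y)`): `Q̃′_kG′_k(U)²Q̃′_k†` positive definite
modulo the displayed positivity of `Δ′_{a′,k}(U)` only. [cite: Balaban1985BackgroundPropagators, Thm 3.11 p.416, (3.25) p.394; Balaban1985Averaging, (18) p.21] -/
theorem QGGQk_pos_of_unitary (ψ : SiteL2K ℂ d m c₁ W) (hψ : ψ ≠ 0) :
    0 < RCLike.re ⟪ψ, (((WL2.linearEquiv ℂ ℂ (fun _ : TSite d m => c₁)).symm.toLinearMap ∘ₗ QprimeTowerW L m n φ U (c₀ := c₀)) ∘ₗ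
        GpOfUk L m n φ η U a' (c₁ := c₁) hpos' ∘ₗ GpOfUk L m n φ η U a' (c₁ := c₁) hpos' ∘ₗ
          LinearMap.adjoint ((WL2.linearEquiv ℂ ℂ (fun _ : TSite d m => c₁)).symm.toLinearMap ∘ₗ QprimeTowerW L m n φ U (c₀ := c₀))) ψ⟫_ℂ :=
  QGGQk_pos L m n φ c₀ η U c₁ a' (adTransportW_adjoint φ τ hτ₂ hU hφ) hpos' ψ hψ

omit [NormOneClass 𝔸] [StarModule ℂ 𝔸] in
/-- **(3.25) for `R_k(U)` at every unitary background**, modulo the displayed positivity of `Δ′_{a′,k}(U)`.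
[cite: Balaban1985BackgroundPropagators, (3.21) p.394, (3.25) p.394; Balaban1985Averaging, (18) p.21] -/
theorem RofUk_eq_formula_of_unitary (f : SiteL2K ℂ d (towerP L m (n + 1)) c₀ W) :
    RofUk L m n φ η U (c₀ := c₀) f = f - GpOfUk L m n φ η U a' (c₁ := c₁) hpos'
      (LinearMap.adjoint ((WL2.linearEquiv ℂ ℂ (fun _ : TSite d m => c₁)).symm.toLinearMap ∘ₗ QprimeTowerW L m n φ U (c₀ := c₀))
        (greenK _ (QGGQk_pos_of_unitary L m n φ c₀ η U c₁ a' τ hτ₂ hφ hU hpos')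
          (((WL2.linearEquiv ℂ ℂ (fun _ : TSite d m => c₁)).symm.toLinearMap ∘ₗ QprimeTowerW L m n φ U (c₀ := c₀))
            (GpOfUk L m n φ η U a' (c₁ := c₁) hpos' f)))) :=
  RofUk_eq_formula L m n φ c₀ η U c₁ a' (adTransportW_adjoint φ τ hτ₂ hU hφ) hpos' f

end Unitary

/-! ## §3 At the flat background `U ≡ 1`: no letter at all -/

section Flat

variable {d : ℕ} (L : ℕ) [NeZero L] (m : Fin d → ℕ) [∀ i, NeZero (m i)] (n : ℕ)
  {𝔸 : Type*} [NormedRing 𝔸] [NormedAlgebra ℂ 𝔸] [CompleteSpace 𝔸] [NormOneClass 𝔸]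
  {W : Type*} [NormedAddCommGroup W] [InnerProductSpace ℂ W] [FiniteDimensional ℂ W] (φ : W ≃ₗ[ℂ] 𝔸) (c₀ : ℝ) [Fact (0 < c₀)]
  (η : ℝ) (c₁ : ℝ) [Fact (0 < c₁)] (a' : ℝ) (hη : η ≠ 0) (ha : 0 < a')

omit [NeZero L] [∀ i, NeZero (m i)] [CompleteSpace 𝔸] [NormOneClass 𝔸] [FiniteDimensional ℂ W] in
/-- The `hRS` letter at `U ≡ 1` on the tower's finest torus (transporters = identity). [cite: Balaban1985BackgroundPropagators, p.395] -/
theorem adTransportW_adjoint_one_tower (b : Bond d (towerP L m (n + 1))) (v u : W) :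
    ⟪adTransportW φ (fun _ : Bond d (towerP L m (n + 1)) => (1 : 𝔸ˣ)) b v, u⟫_ℂ =
      ⟪v, adTransportW φ (fun b : Bond d (towerP L m (n + 1)) => ((fun _ : Bond d (towerP L m (n + 1)) => (1 : 𝔸ˣ)) b)⁻¹) b u⟫_ℂ := by
  have h1 : adTransportW φ (fun _ : Bond d (towerP L m (n + 1)) => (1 : 𝔸ˣ)) b v = v := by
    rw [adTransportW_apply, Units.val_one, inv_one, Units.val_one, one_mul, mul_one, LinearEquiv.symm_apply_apply]
  have h2 : adTransportW φ (fun b : Bond d (towerP L m (n + 1)) => ((fun _ : Bond d (towerP L m (n + 1)) => (1 : 𝔸ˣ)) b)⁻¹) b u = u := by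
    rw [adTransportW_apply, inv_one, Units.val_one, inv_one, Units.val_one, one_mul, mul_one, LinearEquiv.symm_apply_apply]
  rw [h1, h2]

omit [NormOneClass 𝔸] in
include hη ha in
/-- **`Q̃′_kG′_k(1)²Q̃′_k†` is positive definite at the flat background** — `η ≠ 0`, `0 < a′` only (`laplacePrimeAk_one_pos`).
[cite: Balaban1985BackgroundPropagators, Thm 3.11 p.416, (3.25) p.394] -/
theorem QGGQk_pos_one (ψ : SiteL2K ℂ d m c₁ W) (hψ : ψ ≠ 0) :
    0 < RCLike.re ⟪ψ, (((WL2.linearEquiv ℂ ℂ (fun _ : TSite d m => c₁)).symm.toLinearMap ∘ₗ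
        QprimeTowerW L m n φ (fun _ : Bond d (towerP L m (n + 1)) => (1 : 𝔸ˣ)) (c₀ := c₀)) ∘ₗ
        GpOfUk L m n φ η (fun _ : Bond d (towerP L m (n + 1)) => (1 : 𝔸ˣ)) a' (c₁ := c₁) (laplacePrimeAk_one_pos L m n φ η a' hη ha) ∘ₗ
          GpOfUk L m n φ η (fun _ : Bond d (towerP L m (n + 1)) => (1 : 𝔸ˣ)) a' (c₁ := c₁) (laplacePrimeAk_one_pos L m n φ η a' hη ha) ∘ₗ
            LinearMap.adjoint ((WL2.linearEquiv ℂ ℂ (fun _ : TSite d m => c₁)).symm.toLinearMap ∘ₗ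
              QprimeTowerW L m n φ (fun _ : Bond d (towerP L m (n + 1)) => (1 : 𝔸ˣ)) (c₀ := c₀))) ψ⟫_ℂ :=
  QGGQk_pos L m n φ c₀ η _ c₁ a' (adTransportW_adjoint_one_tower L m n φ) _ ψ hψ

omit [NormOneClass 𝔸] in
include hη ha in
/-- **(3.25) for `R_k(1)` at the flat background** — the comparison point of every `k`-level Lipschitz letter `‖R_k(U) − R_k(1)‖`; `G′_k(1)` and
`(Q̃′_kG′_k(1)²Q̃′_k†)⁻¹` CONSTRUCTED from `η ≠ 0`, `0 < a′` only. [cite: Balaban1985BackgroundPropagators, (3.21) p.394, (3.25) p.394] -/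
theorem RofUk_eq_formula_one (f : SiteL2K ℂ d (towerP L m (n + 1)) c₀ W) :
    RofUk L m n φ η (fun _ : Bond d (towerP L m (n + 1)) => (1 : 𝔸ˣ)) (c₀ := c₀) f =
      f - GpOfUk L m n φ η (fun _ : Bond d (towerP L m (n + 1)) => (1 : 𝔸ˣ)) a' (c₁ := c₁) (laplacePrimeAk_one_pos L m n φ η a' hη ha)
        (LinearMap.adjoint ((WL2.linearEquiv ℂ ℂ (fun _ : TSite d m => c₁)).symm.toLinearMap ∘ₗ
            QprimeTowerW L m n φ (fun _ : Bond d (towerP L m (n + 1)) => (1 : 𝔸ˣ)) (c₀ := c₀))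
          (greenK _ (QGGQk_pos_one L m n φ c₀ η c₁ a' hη ha)
            (((WL2.linearEquiv ℂ ℂ (fun _ : TSite d m => c₁)).symm.toLinearMap ∘ₗ
                QprimeTowerW L m n φ (fun _ : Bond d (towerP L m (n + 1)) => (1 : 𝔸ˣ)) (c₀ := c₀))
              (GpOfUk L m n φ η (fun _ : Bond d (towerP L m (n + 1)) => (1 : 𝔸ˣ)) a' (c₁ := c₁) (laplacePrimeAk_one_pos L m n φ η a' hη ha)
                f)))) :=
  RofUk_eq_formula L m n φ c₀ η _ c₁ a' (adTransportW_adjoint_one_tower L m n φ) _ f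

/-! ## §4 The flat `k`-level third operator IS the one-step third operator at block size `L^{n+1}` -/

omit [NormOneClass 𝔸] in
/-- **`Q̃′_kG′_k(1)²Q̃′_k† = Q̃′G′^{(L^{n+1})}(1)²Q̃′†` on `SiteL2K ℂ d m c₁ W`, LITERALLY**, for any two positivity witnesses: `Q̃′_k(1) = Q̃′^{(L^{n+1})}(1)∘Φ′`
(`Qtildek_one_eq_oneStep`), `(A∘Φ′)† = Φ′⁻¹A†`, `G′_k(1) = Φ′⁻¹G′^{(L^{n+1})}(1)Φ′` (`GpOfUk_one_eq_oneStep`), and the site isometry cancels thrice. Hence every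
flat one-step letter of the third operator at block size `L^{n+1}` (NE9 leaf-01's `κ♭`) is a letter of the `k`-level one.
[cite: Balaban1985BackgroundPropagators, (3.25) p.394, (3.19) p.393; Balaban1984PropagatorsI, (1.18) p.20] -/
theorem QGGQk_one_eq_oneStep (h : towerP L m (n + 1) = fineP (L ^ (n + 1)) m)
    (hposk : ∀ x : SiteL2K ℂ d (towerP L m (n + 1)) c₀ W, x ≠ 0 →
      0 < RCLike.re ⟪x, laplacePrimeAk L m n φ η (fun _ : Bond d (towerP L m (n + 1)) => (1 : 𝔸ˣ)) a' (c₁ := c₁) x⟫_ℂ)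
    (hpos1 : ∀ x : SiteL2K ℂ d (fineP (L ^ (n + 1)) m) c₀ W, x ≠ 0 →
      0 < RCLike.re ⟪x, laplacePrimeA (L ^ (n + 1)) m φ η (fun _ : Bond d (fineP (L ^ (n + 1)) m) => (1 : 𝔸ˣ)) a' (c₁ := c₁) x⟫_ℂ) :
    ((WL2.linearEquiv ℂ ℂ (fun _ : TSite d m => c₁)).symm.toLinearMap ∘ₗ
        QprimeTowerW L m n φ (fun _ : Bond d (towerP L m (n + 1)) => (1 : 𝔸ˣ)) (c₀ := c₀)) ∘ₗ
        GpOfUk L m n φ η (fun _ : Bond d (towerP L m (n + 1)) => (1 : 𝔸ˣ)) a' (c₁ := c₁) hposk ∘ₗ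
          GpOfUk L m n φ η (fun _ : Bond d (towerP L m (n + 1)) => (1 : 𝔸ˣ)) a' (c₁ := c₁) hposk ∘ₗ
            LinearMap.adjoint ((WL2.linearEquiv ℂ ℂ (fun _ : TSite d m => c₁)).symm.toLinearMap ∘ₗ
              QprimeTowerW L m n φ (fun _ : Bond d (towerP L m (n + 1)) => (1 : 𝔸ˣ)) (c₀ := c₀)) =
      ((WL2.linearEquiv ℂ ℂ (fun _ : TSite d m => c₁)).symm.toLinearMap ∘ₗ
          QprimeW (L ^ (n + 1)) m φ (fun _ : Bond d (fineP (L ^ (n + 1)) m) => (1 : 𝔸ˣ)) (c₀ := c₀)) ∘ₗ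
        GpOfU (L ^ (n + 1)) m φ η (fun _ : Bond d (fineP (L ^ (n + 1)) m) => (1 : 𝔸ˣ)) a' (c₁ := c₁) hpos1 ∘ₗ
          GpOfU (L ^ (n + 1)) m φ η (fun _ : Bond d (fineP (L ^ (n + 1)) m) => (1 : 𝔸ˣ)) a' (c₁ := c₁) hpos1 ∘ₗ
            LinearMap.adjoint ((WL2.linearEquiv ℂ ℂ (fun _ : TSite d m => c₁)).symm.toLinearMap ∘ₗ
              QprimeW (L ^ (n + 1)) m φ (fun _ : Bond d (fineP (L ^ (n + 1)) m) => (1 : 𝔸ˣ)) (c₀ := c₀)) := by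
  rw [Qtildek_one_eq_oneStep L m n φ h, adjoint_comp_siteL2Cast h, GpOfUk_one_eq_oneStep L m n φ η a' h hposk hpos1]
  apply LinearMap.ext
  intro ψ
  simp only [LinearMap.comp_apply, LinearEquiv.coe_toLinearMap, LinearEquiv.apply_symm_apply]

omit [NormOneClass 𝔸] in
/-- The form reading: `re⟪ψ, Q̃′_kG′_k(1)²Q̃′_k†ψ⟫ = re⟪ψ, Q̃′G′^{(L^{n+1})}(1)²Q̃′†ψ⟫` — so NE9 leaf-01's flat floor at block size `L^{n+1}`
(`B9Eq365QGGQLowerVariational.qggq_coercive_one (L^{n+1})`, constant `qggq_constant_diagonal_ge` on the diagonal `ηL^{n+1} = 1`, `c₀L^{(n+1)d} = c₁`,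
`3 ≤ L^{n+1}`) is the `k`-level `κ♭` BY NAME. [cite: Balaban1985BackgroundPropagators, (3.25) p.394, Thm 3.11 p.416] -/
theorem re_inner_QGGQk_one_eq_oneStep (h : towerP L m (n + 1) = fineP (L ^ (n + 1)) m)
    (hposk : ∀ x : SiteL2K ℂ d (towerP L m (n + 1)) c₀ W, x ≠ 0 →
      0 < RCLike.re ⟪x, laplacePrimeAk L m n φ η (fun _ : Bond d (towerP L m (n + 1)) => (1 : 𝔸ˣ)) a' (c₁ := c₁) x⟫_ℂ)
    (hpos1 : ∀ x : SiteL2K ℂ d (fineP (L ^ (n + 1)) m) c₀ W, x ≠ 0 →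
      0 < RCLike.re ⟪x, laplacePrimeA (L ^ (n + 1)) m φ η (fun _ : Bond d (fineP (L ^ (n + 1)) m) => (1 : 𝔸ˣ)) a' (c₁ := c₁) x⟫_ℂ)
    (ψ : SiteL2K ℂ d m c₁ W) :
    RCLike.re ⟪ψ, (((WL2.linearEquiv ℂ ℂ (fun _ : TSite d m => c₁)).symm.toLinearMap ∘ₗ
        QprimeTowerW L m n φ (fun _ : Bond d (towerP L m (n + 1)) => (1 : 𝔸ˣ)) (c₀ := c₀)) ∘ₗ
        GpOfUk L m n φ η (fun _ : Bond d (towerP L m (n + 1)) => (1 : 𝔸ˣ)) a' (c₁ := c₁) hposk ∘ₗ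
          GpOfUk L m n φ η (fun _ : Bond d (towerP L m (n + 1)) => (1 : 𝔸ˣ)) a' (c₁ := c₁) hposk ∘ₗ
            LinearMap.adjoint ((WL2.linearEquiv ℂ ℂ (fun _ : TSite d m => c₁)).symm.toLinearMap ∘ₗ
              QprimeTowerW L m n φ (fun _ : Bond d (towerP L m (n + 1)) => (1 : 𝔸ˣ)) (c₀ := c₀))) ψ⟫_ℂ =
      RCLike.re ⟪ψ, (((WL2.linearEquiv ℂ ℂ (fun _ : TSite d m => c₁)).symm.toLinearMap ∘ₗ
          QprimeW (L ^ (n + 1)) m φ (fun _ : Bond d (fineP (L ^ (n + 1)) m) => (1 : 𝔸ˣ)) (c₀ := c₀)) ∘ₗ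
        GpOfU (L ^ (n + 1)) m φ η (fun _ : Bond d (fineP (L ^ (n + 1)) m) => (1 : 𝔸ˣ)) a' (c₁ := c₁) hpos1 ∘ₗ
          GpOfU (L ^ (n + 1)) m φ η (fun _ : Bond d (fineP (L ^ (n + 1)) m) => (1 : 𝔸ˣ)) a' (c₁ := c₁) hpos1 ∘ₗ
            LinearMap.adjoint ((WL2.linearEquiv ℂ ℂ (fun _ : TSite d m => c₁)).symm.toLinearMap ∘ₗ
              QprimeW (L ^ (n + 1)) m φ (fun _ : Bond d (fineP (L ^ (n + 1)) m) => (1 : 𝔸ˣ)) (c₀ := c₀))) ψ⟫_ℂ := by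
  rw [QGGQk_one_eq_oneStep L m n φ c₀ η c₁ a' h hposk hpos1]

end Flat

end Literature.MathematicalPhysics.QuantumFieldTheory.Balaban1983to89.B9Eq325ProjFormulaTower

end
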